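import Literature.Topology.FourManifolds.FlowLevelBounds
import Literature.Topology.FourManifolds.BandTwist
import HarnessLib

/-!
# Extending a map of sublevel sets along unit-speed flows

Topic `Literature/Topology/FourManifolds` (fact seat
`provefact-Literature.Topology.FourManifolds.IsHandlebody.exists_isBoundaryGluing_sphere`, step F2b of
the Lickorish–Wallace DAG; data layer of the handle-extension step of the classification of
handlebodies: the *lower correspondence* of `Literature.Topology.FourManifolds.HandlePair`).
Everything here is **proved**; no named facts.

On two manifolds carry functions `f`, `f'`, vector fields with smooth global flows `θ`, `θ'`
of **unit speed** (`X(f) = 1`) on the bands `f⁻¹(a - 6η, a + η)`, `f'⁻¹(a' - 6η, a' + η)`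
(`Literature.Topology.FourManifolds.UnitBand`), and a map `g : M → M'` which is smooth below the
level `a`, shifts levels by `σ = a' - a` on the collar `f⁻¹(a - 6η, a)`, takes deep points to
deep points and **conjugates the flows on the band `f⁻¹(a - 5η, a - η)`** (as it does when the
field on `M` is the pull-back of the field on `M'` there), with an inverse `g'` of the same kind
(`Literature.Topology.FourManifolds.LowerData`).  Flowing down to the reference level `a - 2η`,
applying `g` and flowing up again (Milnor, *Lectures on the h-cobordism theorem* (1965), proof of
Thm. 3.4, PDF p. 13: "extend … by the integral curves of `ξ`") defines

* `LowerData.low` / `LowerData.low'` — the **lower correspondence**: maps `M → M'`, `M' → M`,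
  equal to `g`, `g'` below `a - 3η`, smooth below `a + η` (`contMDiffOn_low`), shifting levels by
  `σ` (`apply_low`), inverse to each other (`low'_low`), conjugating the flows near the level `a`
  (`low_flow`), taking deep points to deep points (`low_below`) — i.e. all the fields of
  `Literature.Topology.FourManifolds.HandlePair` concerning `low`, `low'` — and equal on the feet
  to any map which conjugates the flows and agrees with `g` at the reference level (`low_eq_of`).

Prior art in the tree: `Literature.Topology.FourManifolds.IsUnitBandFlow` (`BandTwist.lean`) is
the unbundled predicate "smooth `f`, smooth field with smooth global flow, `ζ(f) ≥ 0` everywhere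
and `ζ(f) = 1` on a band", with the clock `IsUnitBandFlow.apply_flow_eq_add`; `UnitBand` here is
the *bundled* datum (function, field, flow, level, width) without the global sign condition and
without smoothness of the field (neither is used below), and its clock `UnitBand.apply_flow` is
derived from the same real-induction lemmas `UnitSpeed.eq_add_of_deriv_eq_one` /
`UnitSpeed.eq_sub_of_deriv_eq_one`.

**Side condition for the intended use.**  When the band is instantiated from a
`Literature.Topology.FourManifolds.HandleSide` (same `f`, flow, `a`, `η`), unit speed on the whole
of `f⁻¹(a - 6η, a + η)` forces the core of the handle (where the speed drops to `0` at the
critical point) to lie above the level `a + η`, i.e. the assembly must choose the parameters with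
`a + η ≤ f p - 4r²` and `ℓ₁ ≤ a - 6η`.

## References

* J. Milnor, *Lectures on the h-cobordism theorem* (1965), proofs of Thm. 3.4 (PDF p. 13) and
  Thm. 3.13 (PDF pp. 18–19). [MilnorHCobordism1965]
-/

open scoped Manifold ContDiff Topology
open Set Function Filter Metric

noncomputable section

namespace Literature.Topology.FourManifolds

universe u

variable {n : ℕ} {M : Type u} [TopologicalSpace M] [ChartedSpace (EuclideanHalfSpace (n + 1)) M]
  {M' : Type u} [TopologicalSpace M'] [ChartedSpace (EuclideanHalfSpace (n + 1)) M']

variable (M) in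
/-- **A unit-speed band**: a smooth function `f`, a vector field `X` with a smooth global flow
`θ`, a level `a` and a width `η > 0` such that `X(f) = 1` on `f⁻¹(a - 6η, a + η)` (bundled
variant of `Literature.Topology.FourManifolds.IsUnitBandFlow` without the global sign condition;
see the module docstring for the side condition this imposes on a handle side).
[cite: MilnorHCobordism1965, proof of Thm. 3.4 (PDF p. 13)] -/
structure UnitBand where
  /-- The function. -/
  f : M → ℝ
  /-- The field. -/
  X : Π x : M, TangentSpace (𝓡∂ (n + 1)) x
  /-- Its flow. -/
  θ : ℝ × M → M
  hf : ContMDiff (𝓡∂ (n + 1)) 𝓘(ℝ, ℝ) ∞ f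
  flow : IsSmoothFlow (𝓡∂ (n + 1)) X θ
  /-- The level. -/
  a : ℝ
  /-- The width. -/
  η : ℝ
  η_pos : 0 < η
  unit : ∀ x, f x ∈ Ioo (a - 6 * η) (a + η) → mlineDeriv (𝓡∂ (n + 1)) f x (X x) = 1

namespace UnitBand

variable (B : UnitBand (n := n) M)

/-- The flow is a flow. [folklore] -/
theorem isFlowOf : IsFlowOf (𝓡∂ (n + 1)) B.X B.θ := B.flow.isFlowOf

/-- **The exact level law of a unit-speed flow** ("the clock"): `f (θ (t, x)) = f x + t` as
long as the levels `f x`, `f x + t` lie in the band (the band being an interval, so does the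
whole segment); from `UnitSpeed.eq_add_of_deriv_eq_one` / `UnitSpeed.eq_sub_of_deriv_eq_one`
exactly as `IsUnitBandFlow.apply_flow_eq_add`. [cite: MilnorHCobordism1965, proof of Thm. 3.4 (PDF p. 13)] -/
theorem apply_flow {x : M} (hx : B.f x ∈ Ioo (B.a - 6 * B.η) (B.a + B.η)) {t : ℝ}
    (ht : B.f x + t ∈ Ioo (B.a - 6 * B.η) (B.a + B.η)) : B.f (B.θ (t, x)) = B.f x + t := by
  have hg : ∀ s, HasDerivAt (fun s => B.f (B.θ (s, x)))
      (mlineDeriv (𝓡∂ (n + 1)) B.f (B.θ (s, x)) (B.X (B.θ (s, x)))) s :=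
    fun s => B.isFlowOf.hasDerivAt_apply B.hf x s
  have h1 : ∀ s, B.f (B.θ (s, x)) ∈ Ioo (B.a - 6 * B.η) (B.a + B.η) →
      mlineDeriv (𝓡∂ (n + 1)) B.f (B.θ (s, x)) (B.X (B.θ (s, x))) = 1 := fun s hs => B.unit _ hs
  have h0 : B.f (B.θ (0, x)) = B.f x := by rw [B.isFlowOf.map_zero]
  rcases le_total 0 t with h0t | ht0
  · have := UnitSpeed.eq_add_of_deriv_eq_one hg h1 (t₀ := 0) (T := t) (by rw [h0]; exact hx.1)
      (by rw [h0]; exact ht.2) t ⟨h0t, le_rfl⟩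
    rwa [zero_add, h0] at this
  · have := UnitSpeed.eq_sub_of_deriv_eq_one hg h1 (t₀ := 0) (T := -t) (by rw [h0]; exact hx.2)
      (by rw [h0, sub_neg_eq_add]; exact ht.1) (-t) ⟨neg_nonneg.2 ht0, le_rfl⟩
    rwa [sub_neg_eq_add, zero_add, h0, sub_neg_eq_add] at this

/-- Joint smoothness of `x ↦ θ (τ x, φ x)` for smooth `τ`, `φ`. [folklore] -/
theorem contMDiffAt_flow_comp {N : Type*} [TopologicalSpace N] [ChartedSpace (EuclideanHalfSpace (n + 1)) N]
    {τ : N → ℝ} {φ : N → M} {x : N}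
    (hτ : ContMDiffAt (𝓡∂ (n + 1)) 𝓘(ℝ, ℝ) ∞ τ x) (hφ : ContMDiffAt (𝓡∂ (n + 1)) (𝓡∂ (n + 1)) ∞ φ x) :
    ContMDiffAt (𝓡∂ (n + 1)) (𝓡∂ (n + 1)) ∞ (fun y => B.θ (τ y, φ y)) x :=
  B.flow.contMDiff.contMDiffAt.comp x (hτ.prodMk hφ)

end UnitBand

/-! ### The lower correspondence -/

variable (M M') in
/-- **Data for the lower correspondence**: unit-speed bands on both sides with the same width
and levels `a`, `a' = a + σ`, and a map `g` (with inverse `g'`) which is smooth below `a`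
(resp. `a'`), shifts levels by `σ` on the collar `f⁻¹(a - 6η, a)`, takes `{f ≤ a - 5η}` into
`{f' ≤ a' - 4η}`, and conjugates the flows on the band `f⁻¹(a - 5η, a - η)` (and symmetrically).
[cite: MilnorHCobordism1965, proof of Thm. 3.13 (PDF pp. 18–19)] -/
structure LowerData where
  /-- The first side. -/
  B : UnitBand (n := n) M
  /-- The second side. -/
  B' : UnitBand (n := n) M'
  hη : B'.η = B.η
  /-- The map below the level. -/
  g : M → M'
  /-- Its inverse. -/
  g' : M' → M
  g_smooth : ContMDiffOn (𝓡∂ (n + 1)) (𝓡∂ (n + 1)) ∞ g {x | B.f x < B.a}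
  g'_smooth : ContMDiffOn (𝓡∂ (n + 1)) (𝓡∂ (n + 1)) ∞ g' {x | B'.f x < B'.a}
  apply_g : ∀ x, B.f x ∈ Ioo (B.a - 6 * B.η) B.a → B'.f (g x) = B.f x + (B'.a - B.a)
  apply_g' : ∀ x, B'.f x ∈ Ioo (B'.a - 6 * B'.η) B'.a → B.f (g' x) = B'.f x + (B.a - B'.a)
  g_below : ∀ x, B.f x ≤ B.a - 5 * B.η → B'.f (g x) ≤ B'.a - 4 * B'.η
  g'_below : ∀ x, B'.f x ≤ B'.a - 5 * B'.η → B.f (g' x) ≤ B.a - 4 * B.η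
  g'_g : ∀ x, B.f x < B.a → g' (g x) = x
  g_g' : ∀ x, B'.f x < B'.a → g (g' x) = x
  g_flow : ∀ x t, B.f x ∈ Ioo (B.a - 5 * B.η) (B.a - B.η) → B.f x + t ∈ Ioo (B.a - 5 * B.η) (B.a - B.η) →
    g (B.θ (t, x)) = B'.θ (t, g x)
  g'_flow : ∀ x t, B'.f x ∈ Ioo (B'.a - 5 * B'.η) (B'.a - B'.η) →
    B'.f x + t ∈ Ioo (B'.a - 5 * B'.η) (B'.a - B'.η) → g' (B'.θ (t, x)) = B.θ (t, g' x)

namespace LowerData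

variable (L : LowerData (n := n) M M')

/-- The level shift. [folklore] -/
def σ : ℝ := L.B'.a - L.B.a

/-- Unfolding of `σ`. [folklore] -/
theorem σ_def : L.σ = L.B'.a - L.B.a := rfl

/-- The swapped data. [folklore] -/
def swap : LowerData (n := n) M' M where
  B := L.B'
  B' := L.B
  hη := L.hη.symm
  g := L.g'
  g' := L.g
  g_smooth := L.g'_smooth
  g'_smooth := L.g_smooth
  apply_g := L.apply_g'
  apply_g' := L.apply_g
  g_below := L.g'_below
  g'_below := L.g_below
  g'_g := L.g_g'
  g_g' := L.g'_g
  g_flow := L.g'_flow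
  g'_flow := L.g_flow

/-- First band of the swap. [folklore] -/
@[simp] theorem swap_B : L.swap.B = L.B' := rfl
/-- Second band of the swap. [folklore] -/
@[simp] theorem swap_B' : L.swap.B' = L.B := rfl
/-- Map of the swap. [folklore] -/
@[simp] theorem swap_g : L.swap.g = L.g' := rfl
/-- Inverse map of the swap. [folklore] -/
@[simp] theorem swap_g' : L.swap.g' = L.g := rfl
/-- Swapping twice. [folklore] -/
@[simp] theorem swap_swap : L.swap.swap = L := rfl

/-- **The lower correspondence**: `g` below `a - 3η`; above, flow down to the reference level
`a - 2η`, apply `g`, flow up again. [cite: MilnorHCobordism1965, proof of Thm. 3.4 (PDF p. 13)] -/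
def low (x : M) : M' := by
  classical
  exact if L.B.f x ≤ L.B.a - 3 * L.B.η then L.g x
    else L.B'.θ (L.B.f x - (L.B.a - 2 * L.B.η), L.g (L.B.θ (L.B.a - 2 * L.B.η - L.B.f x, x)))

/-- The inverse lower correspondence (the lower correspondence of the swapped data). [folklore] -/
def low' : M' → M := L.swap.low

/-- Unfolding of `low'`. [folklore] -/
theorem low'_def : L.low' = L.swap.low := rfl

/-- The formula branch of `low`. [folklore] -/
def lowFormula (x : M) : M' :=
  L.B'.θ (L.B.f x - (L.B.a - 2 * L.B.η), L.g (L.B.θ (L.B.a - 2 * L.B.η - L.B.f x, x)))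

/-- The lower branch of `low`. [folklore] -/
theorem low_of_le {x : M} (hx : L.B.f x ≤ L.B.a - 3 * L.B.η) : L.low x = L.g x := by
  simp [low, hx]

/-- The upper branch of `low`. [folklore] -/
theorem low_of_lt {x : M} (hx : L.B.a - 3 * L.B.η < L.B.f x) : L.low x = L.lowFormula x := by
  simp [low, not_le.2 hx, lowFormula]

/-- Level of the foot point `θ (a - 2η - f x, x)`: it is `a - 2η`, for `f x ∈ (a - 6η, a + η)`. [folklore] -/
theorem apply_foot {x : M} (hx : L.B.f x ∈ Ioo (L.B.a - 6 * L.B.η) (L.B.a + L.B.η)) :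
    L.B.f (L.B.θ (L.B.a - 2 * L.B.η - L.B.f x, x)) = L.B.a - 2 * L.B.η := by
  have h := L.B.apply_flow hx (t := L.B.a - 2 * L.B.η - L.B.f x)
    ⟨by linarith [L.B.η_pos], by linarith [L.B.η_pos]⟩
  linarith [h]

/-- **On the band `(a - 5η, a - η)` the formula gives back `g`** (flow conjugation).
[cite: MilnorHCobordism1965, proof of Thm. 3.13 (PDF p. 18)] -/
theorem lowFormula_eq_g {x : M} (hx : L.B.f x ∈ Ioo (L.B.a - 5 * L.B.η) (L.B.a - L.B.η)) :
    L.lowFormula x = L.g x := by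
  have hη := L.B.η_pos
  set t := L.B.a - 2 * L.B.η - L.B.f x with ht
  have hconj := L.g_flow x t hx (by rw [ht]; constructor <;> linarith)
  unfold lowFormula
  rw [show L.B.f x - (L.B.a - 2 * L.B.η) = -t by rw [ht]; ring, hconj]
  exact L.B'.isFlowOf.map_neg_map t (L.g x)

/-- `low = g` below `a - η`. [folklore] -/
theorem low_eq_g {x : M} (hx : L.B.f x < L.B.a - L.B.η) : L.low x = L.g x := by
  by_cases h : L.B.f x ≤ L.B.a - 3 * L.B.η
  · exact L.low_of_le h
  · rw [L.low_of_lt (not_le.1 h)]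
    exact L.lowFormula_eq_g ⟨by linarith [L.B.η_pos, not_le.1 h], hx⟩

/-- `low = lowFormula` on `(a - 5η, a + η)`. [folklore] -/
theorem low_eq_lowFormula {x : M} (hx : L.B.f x ∈ Ioo (L.B.a - 5 * L.B.η) (L.B.a + L.B.η)) :
    L.low x = L.lowFormula x := by
  by_cases h : L.B.f x ≤ L.B.a - 3 * L.B.η
  · rw [L.low_of_le h, L.lowFormula_eq_g ⟨hx.1, by linarith [L.B.η_pos]⟩]
  · exact L.low_of_lt (not_le.1 h)

/-- **Level law of the formula**: `f' (lowFormula x) = f x + σ` for `f x ∈ (a - 5η, a + η)`.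
[cite: MilnorHCobordism1965, proof of Thm. 3.13 (PDF pp. 18–19)] -/
theorem apply_lowFormula {x : M} (hx : L.B.f x ∈ Ioo (L.B.a - 5 * L.B.η) (L.B.a + L.B.η)) :
    L.B'.f (L.lowFormula x) = L.B.f x + L.σ := by
  have hη := L.B.η_pos
  have hη' := L.hη
  have hfoot := L.apply_foot (x := x) ⟨by linarith [hx.1], hx.2⟩
  have hg : L.B'.f (L.g (L.B.θ (L.B.a - 2 * L.B.η - L.B.f x, x))) = L.B'.a - 2 * L.B.η := by
    rw [L.apply_g _ (by rw [hfoot]; constructor <;> linarith), hfoot]; ring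
  unfold lowFormula
  rw [L.B'.apply_flow (by rw [hg, hη']; constructor <;> linarith) (by rw [hg, hη']; constructor <;> linarith [hx.1, hx.2]),
    hg, σ_def]
  ring

/-- **Level law of the lower correspondence** near the level `a`. [cite: MilnorHCobordism1965, proof of Thm. 3.13 (PDF pp. 18–19)] -/
theorem apply_low {x : M} (hx : L.B.f x ∈ Ioo (L.B.a - 5 * L.B.η) (L.B.a + L.B.η)) :
    L.B'.f (L.low x) = L.B.f x + L.σ := by
  rw [L.low_eq_lowFormula hx]; exact L.apply_lowFormula hx

/-- **Deep points go to deep points.** [folklore] -/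
theorem low_below {x : M} (hx : L.B.f x < L.B.a - L.B.η / 4) : L.B'.f (L.low x) < L.B'.a - L.B'.η / 4 := by
  have hη := L.B.η_pos
  have hη' := L.hη
  by_cases h5 : L.B.f x ≤ L.B.a - 5 * L.B.η
  · rw [L.low_of_le (by linarith)]
    have := L.g_below x h5
    rw [hη'] at this ⊢; linarith
  · push Not at h5
    rw [L.apply_low ⟨h5, by linarith⟩, σ_def, hη']
    linarith

/-- **Smoothness of the formula** at points of `(a - 6η, a + η)` (there the foot point is below `a`). [folklore] -/
theorem contMDiffAt_lowFormula {x : M} (hx : L.B.f x ∈ Ioo (L.B.a - 6 * L.B.η) (L.B.a + L.B.η)) :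
    ContMDiffAt (𝓡∂ (n + 1)) (𝓡∂ (n + 1)) ∞ L.lowFormula x := by
  have hη := L.B.η_pos
  have hfoot := L.apply_foot hx
  have hinner : ContMDiffAt (𝓡∂ (n + 1)) (𝓡∂ (n + 1)) ∞
      (fun y => L.B.θ (L.B.a - 2 * L.B.η - L.B.f y, y)) x :=
    L.B.contMDiffAt_flow_comp (contMDiffAt_const.sub L.B.hf.contMDiffAt) contMDiffAt_id
  have hg : ContMDiffAt (𝓡∂ (n + 1)) (𝓡∂ (n + 1)) ∞ L.g (L.B.θ (L.B.a - 2 * L.B.η - L.B.f x, x)) :=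
    L.g_smooth.contMDiffAt ((isOpen_lt L.B.hf.continuous continuous_const).mem_nhds
      (by show L.B.f _ < L.B.a; rw [hfoot]; linarith))
  exact L.B'.contMDiffAt_flow_comp (L.B.hf.contMDiffAt.sub contMDiffAt_const) (hg.comp x hinner)

/-- **The lower correspondence is smooth below `a + η`.** [cite: MilnorHCobordism1965, proof of Thm. 3.13 (PDF pp. 18–19)] -/
theorem contMDiffOn_low : ContMDiffOn (𝓡∂ (n + 1)) (𝓡∂ (n + 1)) ∞ L.low {x | L.B.f x < L.B.a + L.B.η} := by
  have hη := L.B.η_pos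
  intro x hx
  have hx' : L.B.f x < L.B.a + L.B.η := hx
  apply ContMDiffAt.contMDiffWithinAt
  by_cases h : L.B.f x < L.B.a - L.B.η
  · -- near `x`, `low = g`
    have hev : L.low =ᶠ[𝓝 x] L.g := by
      by_cases h4 : L.B.f x < L.B.a - 4 * L.B.η
      · filter_upwards [(isOpen_lt L.B.hf.continuous continuous_const).mem_nhds
          (show L.B.f x < L.B.a - 3 * L.B.η by linarith)] with y hy
        exact L.low_of_le (le_of_lt hy)
      · push Not at h4
        have hmem : L.B.f x ∈ Ioo (L.B.a - 5 * L.B.η) (L.B.a - L.B.η) := ⟨by linarith, h⟩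
        filter_upwards [(isOpen_Ioo.preimage L.B.hf.continuous).mem_nhds hmem] with y hy
        exact L.low_eq_g hy.2
    exact (L.g_smooth.contMDiffAt ((isOpen_lt L.B.hf.continuous continuous_const).mem_nhds
      (show L.B.f x < L.B.a by linarith))).congr_of_eventuallyEq hev
  · -- near `x`, `low = lowFormula`
    push Not at h
    have hmem : L.B.f x ∈ Ioo (L.B.a - 5 * L.B.η) (L.B.a + L.B.η) := ⟨by linarith, hx'⟩
    have hev : L.low =ᶠ[𝓝 x] L.lowFormula := by
      filter_upwards [(isOpen_Ioo.preimage L.B.hf.continuous).mem_nhds hmem] with y hy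
      exact L.low_eq_lowFormula hy
    exact (L.contMDiffAt_lowFormula ⟨by linarith, hx'⟩).congr_of_eventuallyEq hev

/-- **The flow is conjugated near the level `a`**: `low (θ (t, x)) = θ' (t, low x)` for
`f x, f x + t ∈ (a - 5η, a + η)`. [cite: MilnorHCobordism1965, proof of Thm. 3.13 (PDF pp. 18–19)] -/
theorem low_flow {x : M} {t : ℝ} (hx : L.B.f x ∈ Ioo (L.B.a - 5 * L.B.η) (L.B.a + L.B.η))
    (ht : L.B.f x + t ∈ Ioo (L.B.a - 5 * L.B.η) (L.B.a + L.B.η)) :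
    L.low (L.B.θ (t, x)) = L.B'.θ (t, L.low x) := by
  have hη := L.B.η_pos
  have hlev : L.B.f (L.B.θ (t, x)) = L.B.f x + t :=
    L.B.apply_flow ⟨by linarith [hx.1], hx.2⟩ ⟨by linarith [ht.1], ht.2⟩
  rw [L.low_eq_lowFormula (by rw [hlev]; exact ht), L.low_eq_lowFormula hx]
  unfold lowFormula
  rw [hlev, L.B.isFlowOf.map_add, show L.B.a - 2 * L.B.η - (L.B.f x + t) + t = L.B.a - 2 * L.B.η - L.B.f x by ring,
    show L.B.f x + t - (L.B.a - 2 * L.B.η) = t + (L.B.f x - (L.B.a - 2 * L.B.η)) by ring,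
    ← L.B'.isFlowOf.map_add]

/-- **`low' ∘ low = id` below `a + η`.** [folklore] -/
theorem low'_low {x : M} (hx : L.B.f x < L.B.a + L.B.η) : L.low' (L.low x) = x := by
  have hη := L.B.η_pos
  have hη' := L.hη
  rw [low'_def]
  by_cases h5 : L.B.f x ≤ L.B.a - 5 * L.B.η
  · -- deep: both maps are `g`, `g'`
    rw [L.low_of_le (by linarith)]
    have hlev : L.B'.f (L.g x) ≤ L.B'.a - 3 * L.B'.η := by
      have := L.g_below x h5; linarith [L.B'.η_pos]
    rw [L.swap.low_of_le (by simpa using hlev)]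
    exact L.g'_g x (by linarith)
  · push Not at h5
    have hmem : L.B.f x ∈ Ioo (L.B.a - 5 * L.B.η) (L.B.a + L.B.η) := ⟨h5, hx⟩
    by_cases h3 : L.B.f x ≤ L.B.a - 3 * L.B.η
    · -- middle: `low x = g x`, at level `f x + σ ≤ a' - 3η`
      rw [L.low_of_le h3]
      have hlev : L.B'.f (L.g x) = L.B.f x + L.σ := by
        rw [← L.lowFormula_eq_g ⟨h5, by linarith⟩]; exact L.apply_lowFormula hmem
      rw [L.swap.low_of_le (by simp only [swap_B]; rw [hlev, σ_def, hη']; linarith)]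
      exact L.g'_g x (by linarith)
    · -- top: the formula on both sides
      push Not at h3
      rw [L.low_of_lt h3]
      have hlev := L.apply_lowFormula hmem
      rw [L.swap.low_of_lt (by simp only [swap_B]; rw [hlev, σ_def, hη']; linarith)]
      have hfoot := L.apply_foot (x := x) ⟨by linarith, hx⟩
      set y := L.lowFormula x with hy
      show L.B.θ (L.B'.f y - (L.B'.a - 2 * L.B'.η), L.g' (L.B'.θ (L.B'.a - 2 * L.B'.η - L.B'.f y, y))) = x
      have e1 : L.B'.a - 2 * L.B'.η - (L.B.f x + L.σ) = -(L.B.f x - (L.B.a - 2 * L.B.η)) := by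
        rw [σ_def, hη']; ring
      have e2 : L.B.a - 2 * L.B.η - L.B.f x = -(L.B.f x - (L.B.a - 2 * L.B.η)) := by ring
      have e3 : L.B.f x + L.σ - (L.B'.a - 2 * L.B'.η) = L.B.f x - (L.B.a - 2 * L.B.η) := by
        rw [σ_def, hη']; ring
      rw [hlev, e1, e3, hy]
      unfold lowFormula
      rw [L.B'.isFlowOf.map_neg_map, L.g'_g _ (by rw [hfoot]; linarith), e2, L.B.isFlowOf.map_map_neg]

/-- **Agreement on the feet.**  If `φ : M → M'` conjugates the flows along the orbit segment
from the foot point `v = θ (a - 2η - f x, x)` to `x` and agrees with `g` at `v`, then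
`low x = φ x` (`f x ∈ (a - 3η, a + η)`). [cite: MilnorHCobordism1965, proof of Thm. 3.13 (PDF pp. 18–19)] -/
theorem low_eq_of {x : M} (hx : L.B.f x ∈ Ioo (L.B.a - 3 * L.B.η) (L.B.a + L.B.η)) {φ : M → M'}
    (hφg : L.g (L.B.θ (L.B.a - 2 * L.B.η - L.B.f x, x)) = φ (L.B.θ (L.B.a - 2 * L.B.η - L.B.f x, x)))
    (hφflow : φ x = L.B'.θ (L.B.f x - (L.B.a - 2 * L.B.η), φ (L.B.θ (L.B.a - 2 * L.B.η - L.B.f x, x)))) :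
    L.low x = φ x := by
  rw [L.low_of_lt hx.1, lowFormula, hφg, ← hφflow]

end LowerData

end Literature.Topology.FourManifolds
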